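import Mathlib
import HarnessLib
import Literature.NumberTheory.LFunctions.ZetaScrew
import Summits.RiemannHypothesis.RiemannHypothesis.Theorems.IntegerScrewRung128
import Summits.RiemannHypothesis.RiemannHypothesis.Theorems.MotivicDoorSemilocalClosed
import Summits.RiemannHypothesis.RiemannHypothesis.Theorems.WeilFormatCDataA1RungCB
import Summits.RiemannHypothesis.RiemannHypothesis.Theorems.IntegerScrewTopBlockNegHead
import Summits.RiemannHypothesis.RiemannHypothesis.Theorems.DbrLatticeAntipersistence
import Summits.RiemannHypothesis.RiemannHypothesis.Theorems.DbrWallLogTableA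
import Summits.RiemannHypothesis.RiemannHypothesis.Theorems.InventoryDeletionBlindnessDetTwo
import Literature.NumberTheory.LFunctions.VinogradovKorobovThreeHalvesLine

/-!
# W-06 cycle 5, cell C4⁵ (T) «DELETION-UNIFORM TRANSFERS» — Detection at p₁ = 3

Detection at floor `p₁ = 3` (kernel): `S_4(ζ_{ℙ∖{3}})` is not PSD — witness `x = (1, 1, −1)`.
On the nodes `log 2, log 3, log 4` the deletion `D = {3}` perturbs only the node value `Ψ(log 4) ↦ Ψ(log 4) + φ₄`.
The quadratic form at `x = (1,1,−1)` is `< 0` (kernel certificate), hence `M₀(ℙ∖{3}) = 4 = p₁ + 1`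
(blind at `M ≤ 3` by §3), and the calibration pin `f((log 3)/2) ≤ 3`.

TEST 0: both sides are finite rungs; 0 bits toward `Re ρ(ζ)`. Nothing here bears on the truth of RH.
-/

set_option linter.dupNamespace false

namespace RhIdea6.G14.Transfer

open Literature.NumberTheory.LFunctions Finset
open Summit.RiemannHypothesis.RiemannHypothesis.Theorems.IntegerScrew
open Literature.Analysis.ValidatedNumerics Literature.Analysis.ValidatedNumerics.Numerics
open Summit.RiemannHypothesis.RiemannHypothesis.Theorems.IntegerScrew.RungCert
open Summit.RiemannHypothesis.RiemannHypothesis.Theorems.IntegerScrew.TopBlockNeg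
open Summit.RiemannHypothesis.RiemannHypothesis.Theorems.DbrLattice
open Summit.RiemannHypothesis.RiemannHypothesis.Theorems.DbrWall.LogTable (log_three_bounds)
open scoped BigOperators

/-! ## §7. Detection at the floor `p₁ = 3` (kernel): `S_4(ζ_{ℙ∖{3}})` is not PSD — witness `x = (1, 1, −1)`

On the nodes `log 2, log 3, log 4` the deletion `D = {3}` perturbs only the node value `Ψ(log 4) ↦ Ψ(log 4) + φ₄`,
`φ₄ = (log 3)(log 4 − log 3)/√3 ≈ 0.18247` (the deleted power `3` is the only one below `4` with a non-zero hinge; all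
differences have `e^{|t|} ≤ 2 < 3`).  The quadratic form at `x = (1,1,−1)` equals
`C + 4u(2,1) + 2u(3,1) − 2u(4,1) − 2u(3,2) + 2u(4,3) − 2φ₄ ≈ 0.30694 − 0.36494 = −0.058 < 0` (LINEAR in the enclosed
quantities, so one `decide` on the rung-128 table settles it).  Hence `M₀(ℙ∖{3}) = 4 = p₁ + 1` in kernel form
(blind at `M ≤ 3` by §3), and the calibration pin `f((log 3)/2) ≤ 3`. -/

/-- `Ψ_D`'s Gram matrix is symmetric (`Ψ_D` is even). [folklore] -/
theorem keptScrewMatrix_symm (D : Finset ℕ) (n : ℕ) (i j : Fin n) :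
    keptScrewMatrix D n j i = keptScrewMatrix D n i j := by
  simp only [keptScrewMatrix, Matrix.of_apply]
  rw [show Real.log (((j : ℕ) + 2 : ℕ) : ℝ) - Real.log (((i : ℕ) + 2 : ℕ) : ℝ)
      = -(Real.log (((i : ℕ) + 2 : ℕ) : ℝ) - Real.log (((j : ℕ) + 2 : ℕ) : ℝ)) by ring, keptScrew_neg]
  ring

/-- `φ_{{3}}(log 4) = (log 3/√3)(log 4 − log 3)`. [folklore] -/
theorem deletedHinge_three_log_four :
    deletedHinge {3} (Real.log 4) = Real.log 3 / Real.sqrt 3 * (Real.log 4 - Real.log 3) := by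
  have h := deletedHinge_log_nat {3} (m := 4) (by norm_num)
  push_cast at h
  rw [h, show Finset.Icc (1 : ℕ) 4 = {1, 2, 3, 4} from by decide,
    Finset.sum_insert (by decide), Finset.sum_insert (by decide), Finset.sum_pair (by norm_num)]
  have m2 : (2 : ℕ).minFac = 2 := by norm_num
  have m3 : (3 : ℕ).minFac = 3 := by norm_num
  have m4 : (4 : ℕ).minFac = 2 := by norm_num
  have hΛ3 : ArithmeticFunction.vonMangoldt 3 = Real.log 3 := by
    rw [ArithmeticFunction.vonMangoldt_apply_prime Nat.prime_three]; norm_num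
  simp [Nat.minFac_one, m2, m3, m4, hΛ3]

/-- `Ψ_{{3}}(log 3) = Ψ(log 3)` (the deleted power `3` sits exactly at the node: hinge `0`). [folklore] -/
theorem keptScrew_three_log_three : keptScrew {3} (Real.log 3) = zetaScrew (Real.log 3) := by
  apply keptScrew_eq_of_forall_le
  intro p hp
  rw [Finset.mem_singleton] at hp
  subst hp
  rw [abs_of_nonneg (Real.log_nonneg (by norm_num)), Real.exp_log (by norm_num)]
  norm_num

/-- `Ψ_{{3}}(log 2 − log 3) = Ψ(log 2 − log 3)` (`e^{|t|} = 3/2 ≤ 3`). [folklore] -/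
theorem keptScrew_three_log_two_sub_log_three :
    keptScrew {3} (Real.log 2 - Real.log 3) = zetaScrew (Real.log 2 - Real.log 3) := by
  apply keptScrew_eq_of_forall_le
  intro p hp
  rw [Finset.mem_singleton] at hp
  subst hp
  refine (exp_abs_log_sub_log_le (a := 2) (b := 3) (by norm_num) (by norm_num)).trans ?_
  norm_num

/-- `Ψ_{{3}}(log 3 − log 4) = Ψ(log 3 − log 4)` (`e^{|t|} = 4/3 ≤ 3`). [folklore] -/
theorem keptScrew_three_log_three_sub_log_four :
    keptScrew {3} (Real.log 3 - Real.log 4) = zetaScrew (Real.log 3 - Real.log 4) := by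
  apply keptScrew_eq_of_forall_le
  intro p hp
  rw [Finset.mem_singleton] at hp
  subst hp
  have h34 : Real.log 3 < Real.log 4 := Real.log_lt_log (by norm_num) (by norm_num)
  have habs : |Real.log 3 - Real.log 4| = Real.log (4 / 3) := by
    rw [abs_of_neg (by linarith), Real.log_div (by norm_num) (by norm_num)]; ring
  rw [habs, Real.exp_log (by norm_num)]
  norm_num

/-- The deleted weight `φ₄ = (log 3/√3)(log 4 − log 3) ≥ 0.18246`. [folklore] -/
theorem phi4_lower : (0.18246 : ℝ) ≤ Real.log 3 / Real.sqrt 3 * (Real.log 4 - Real.log 3) := by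
  have hl2 := Real.log_two_gt_d9
  have hl2' := Real.log_two_lt_d9
  obtain ⟨hl3, hl3'⟩ := log_three_bounds
  rw [Literature.NumberTheory.LFunctions.FordLambda.log_4_eq]
  set s := Real.sqrt 3 with hs
  have hs2 : s ^ 2 = 3 := Real.sq_sqrt (by norm_num)
  have hs0 : 0 < s := Real.sqrt_pos.mpr (by norm_num)
  have hshi : s < (1.732051 : ℝ) := by nlinarith
  have e : Real.log 3 / s * (2 * Real.log 2 - Real.log 3) = Real.log 3 * (2 * Real.log 2 - Real.log 3) / s := by
    rw [div_mul_eq_mul_div]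
  rw [e, le_div_iff₀ hs0]
  have hA : 0 ≤ (Real.log 3 - 1.0986122886680) * (2 * Real.log 2 - Real.log 3 - 0.2876820719) :=
    mul_nonneg (by linarith) (by linarith)
  nlinarith

/-- Entries of the kept `S_4` for `D = {3}` (nodes `log 2, log 3, log 4`). [folklore] -/
theorem kept3Entry00 : keptScrewMatrix {3} 3 0 0 = 2 * (uR 2 1 + lerchC / 4) := by
  have hΨ := zetaScrew_log_nat 2
  push_cast at hΨ
  have e : keptScrewMatrix {3} 3 0 0 =
      keptScrew {3} (Real.log 2) + keptScrew {3} (Real.log 2) - keptScrew {3} (Real.log 2 - Real.log 2) := by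
    simp [keptScrewMatrix, Matrix.of_apply]
  rw [e, sub_self, keptScrew_zero', keptScrew, deletedHinge_log_two, hΨ]; ring

/-- Entry `(1,1)` of kept `S_4` for `D = {3}`: `2Ψ(log 3)`. [folklore] -/
theorem kept3Entry11 : keptScrewMatrix {3} 3 1 1 = 2 * (uR 3 1 + lerchC / 4) := by
  have hΨ := zetaScrew_log_nat 3
  push_cast at hΨ
  have e : keptScrewMatrix {3} 3 1 1 =
      keptScrew {3} (Real.log 3) + keptScrew {3} (Real.log 3) - keptScrew {3} (Real.log 3 - Real.log 3) := by
    simp [keptScrewMatrix, Matrix.of_apply]; norm_num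
  rw [e, sub_self, keptScrew_zero', keptScrew_three_log_three, hΨ]; ring

/-- Entry `(2,2)` of kept `S_4` for `D = {3}`: `2Ψ(log 4) + 2φ₄`. [folklore] -/
theorem kept3Entry22 : keptScrewMatrix {3} 3 2 2 =
    2 * (uR 4 1 + lerchC / 4) + 2 * (Real.log 3 / Real.sqrt 3 * (Real.log 4 - Real.log 3)) := by
  have hΨ := zetaScrew_log_nat 4
  push_cast at hΨ
  have e : keptScrewMatrix {3} 3 2 2 =
      keptScrew {3} (Real.log 4) + keptScrew {3} (Real.log 4) - keptScrew {3} (Real.log 4 - Real.log 4) := by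
    simp [keptScrewMatrix, Matrix.of_apply]; norm_num
  rw [e, sub_self, keptScrew_zero', keptScrew, deletedHinge_three_log_four, hΨ]; ring

/-- Entry `(0,1)` of kept `S_4` for `D = {3}`: `Ψ(log 2) + Ψ(log 3) − Ψ(log 2 − log 3)`. [folklore] -/
theorem kept3Entry01 : keptScrewMatrix {3} 3 0 1 =
    (uR 2 1 + lerchC / 4) + (uR 3 1 + lerchC / 4) - (uR 3 2 + lerchC / 4) := by
  have hΨ2 := zetaScrew_log_nat 2
  have hΨ3 := zetaScrew_log_nat 3
  have hΨ32 := zetaScrew_log_sub_eq_uR (x := 0) (y := 1) (by norm_num)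
  push_cast at hΨ2 hΨ3 hΨ32
  norm_num at hΨ32
  have e : keptScrewMatrix {3} 3 0 1 =
      keptScrew {3} (Real.log 2) + keptScrew {3} (Real.log 3) - keptScrew {3} (Real.log 2 - Real.log 3) := by
    simp [keptScrewMatrix, Matrix.of_apply]; norm_num
  rw [e, keptScrew_three_log_three, keptScrew_three_log_two_sub_log_three, keptScrew, deletedHinge_log_two,
    hΨ2, hΨ3, hΨ32]
  ring

/-- Entry `(0,2)` of kept `S_4` for `D = {3}`: off-diagonal Ψ + φ₄ term. [folklore] -/
theorem kept3Entry02 : keptScrewMatrix {3} 3 0 2 =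
    (uR 4 1 + lerchC / 4) + Real.log 3 / Real.sqrt 3 * (Real.log 4 - Real.log 3) := by
  have hΨ4 := zetaScrew_log_nat 4
  push_cast at hΨ4
  have e : keptScrewMatrix {3} 3 0 2 =
      keptScrew {3} (Real.log 2) + keptScrew {3} (Real.log 4) - keptScrew {3} (Real.log 2 - Real.log 4) := by
    simp [keptScrewMatrix, Matrix.of_apply]; norm_num
  rw [e, show Real.log 2 - Real.log 4 = -Real.log 2 by rw [Literature.NumberTheory.LFunctions.FordLambda.log_4_eq]; ring, keptScrew_neg]
  simp only [keptScrew]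
  rw [deletedHinge_log_two, deletedHinge_three_log_four, hΨ4]
  ring

/-- Entry `(1,2)` of kept `S_4` for `D = {3}`: `Ψ(log 3) + Ψ(log 4) − Ψ(log 3 − log 4) + φ₄`. [folklore] -/
theorem kept3Entry12 : keptScrewMatrix {3} 3 1 2 =
    (uR 3 1 + lerchC / 4) + ((uR 4 1 + lerchC / 4) + Real.log 3 / Real.sqrt 3 * (Real.log 4 - Real.log 3))
      - (uR 4 3 + lerchC / 4) := by
  have hΨ3 := zetaScrew_log_nat 3
  have hΨ4 := zetaScrew_log_nat 4
  have hΨ43 := zetaScrew_log_sub_eq_uR (x := 1) (y := 2) (by norm_num)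
  push_cast at hΨ3 hΨ4 hΨ43
  norm_num at hΨ43
  have e : keptScrewMatrix {3} 3 1 2 =
      keptScrew {3} (Real.log 3) + keptScrew {3} (Real.log 4) - keptScrew {3} (Real.log 3 - Real.log 4) := by
    simp [keptScrewMatrix, Matrix.of_apply]; norm_num
  rw [e, keptScrew_three_log_three, keptScrew_three_log_three_sub_log_four]
  simp only [keptScrew]
  rw [deletedHinge_three_log_four, hΨ3, hΨ4, hΨ43]

/-- The kernel decision for the witness `(1,1,−1)` (ℚ, scale `SC = 2^48`; `φ₄ ≥ 0.18246`):
`C⁺s + 4hi(u21) + 2hi(u31) − 2lo(u41) − 2lo(u32) + 2hi(u43) − 2·0.18246·s < 0`. [folklore] -/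
theorem witness3CheckQ :
    cHiQ * (SC : ℚ) + 4 * ((ug utab127 2 1).hi : ℚ) + 2 * ((ug utab127 3 1).hi : ℚ)
      - 2 * ((ug utab127 4 1).lo : ℚ) - 2 * ((ug utab127 3 2).lo : ℚ) + 2 * ((ug utab127 4 3).hi : ℚ)
      - 2 * (18246 * (SC : ℚ) / 100000) < 0 := by
  decide +kernel

/-- **DETECTION AT THE FLOOR `p₁ = 3` (RH-FREE certified inequality):** the kept `S_4(ζ_{ℙ∖{3}})` takes the
value `≈ −0.058 < 0` at `x = (1, 1, −1)`, hence is NOT positive semidefinite: `M₀(ℙ∖{3}) = 4`. [folklore] -/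
theorem keptScrewMatrix_three_not_posSemidef : ¬ (keptScrewMatrix {3} 3).PosSemidef := by
  intro hM
  have hq := hM.dotProduct_mulVec_nonneg ![1, 1, -1]
  have e : dotProduct (star ![(1 : ℝ), 1, -1]) ((keptScrewMatrix {3} 3).mulVec ![1, 1, -1]) =
      keptScrewMatrix {3} 3 0 0 + keptScrewMatrix {3} 3 1 1 + keptScrewMatrix {3} 3 2 2
        + 2 * keptScrewMatrix {3} 3 0 1 - 2 * keptScrewMatrix {3} 3 0 2 - 2 * keptScrewMatrix {3} 3 1 2 := by
    rw [← keptScrewMatrix_symm {3} 3 0 1, ← keptScrewMatrix_symm {3} 3 0 2, ← keptScrewMatrix_symm {3} 3 1 2]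
    simp [dotProduct, Matrix.mulVec, Fin.sum_univ_three, keptScrewMatrix_symm]
    ring
  rw [e, kept3Entry00, kept3Entry11, kept3Entry22, kept3Entry01, kept3Entry02, kept3Entry12] at hq
  obtain ⟨l21, h21⟩ := mem_uR_utab127 (a := 2) (b := 1) (by norm_num) (by norm_num) (by norm_num)
  obtain ⟨l31, h31⟩ := mem_uR_utab127 (a := 3) (b := 1) (by norm_num) (by norm_num) (by norm_num)
  obtain ⟨l41, h41⟩ := mem_uR_utab127 (a := 4) (b := 1) (by norm_num) (by norm_num) (by norm_num)
  obtain ⟨l32, h32⟩ := mem_uR_utab127 (a := 3) (b := 2) (by norm_num) (by norm_num) (by norm_num)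
  obtain ⟨l43, h43⟩ := mem_uR_utab127 (a := 4) (b := 3) (by norm_num) (by norm_num) (by norm_num)
  have plo := phi4_lower
  have hChi : lerchC ≤ ((cHiQ : ℚ) : ℝ) := lerchC_le_cHiQ
  have hSC : (0 : ℝ) < ((SC : ℕ) : ℝ) := SC_pos
  have hltr : ((cHiQ : ℚ) : ℝ) * (SC : ℝ) + 4 * (((ug utab127 2 1).hi : ℤ) : ℝ) + 2 * (((ug utab127 3 1).hi : ℤ) : ℝ)
      - 2 * (((ug utab127 4 1).lo : ℤ) : ℝ) - 2 * (((ug utab127 3 2).lo : ℤ) : ℝ) + 2 * (((ug utab127 4 3).hi : ℤ) : ℝ)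
      - 2 * (18246 * (SC : ℝ) / 100000) < 0 := by
    have h' := (Rat.cast_lt (K := ℝ)).2 witness3CheckQ; push_cast at h'; linarith
  set C := lerchC with hCdef
  set s := ((SC : ℕ) : ℝ) with hsdef
  set φ := Real.log 3 / Real.sqrt 3 * (Real.log 4 - Real.log 3) with hφ
  have hCs_hi : C * s ≤ ((cHiQ : ℚ) : ℝ) * s := mul_le_mul_of_nonneg_right hChi hSC.le
  have hφs_lo : 18246 * s / 100000 ≤ φ * s := by
    have := mul_le_mul_of_nonneg_right plo hSC.le; linarith
  -- the quadratic form, scaled by `s`, is below the decided negative rational combination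
  have hQ : (2 * (uR 2 1 + C / 4) + 2 * (uR 3 1 + C / 4) + (2 * (uR 4 1 + C / 4) + 2 * φ)
      + 2 * ((uR 2 1 + C / 4) + (uR 3 1 + C / 4) - (uR 3 2 + C / 4))
      - 2 * ((uR 4 1 + C / 4) + φ)
      - 2 * ((uR 3 1 + C / 4) + ((uR 4 1 + C / 4) + φ) - (uR 4 3 + C / 4))) * s < 0 := by
    have expand : (2 * (uR 2 1 + C / 4) + 2 * (uR 3 1 + C / 4) + (2 * (uR 4 1 + C / 4) + 2 * φ)
        + 2 * ((uR 2 1 + C / 4) + (uR 3 1 + C / 4) - (uR 3 2 + C / 4))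
        - 2 * ((uR 4 1 + C / 4) + φ)
        - 2 * ((uR 3 1 + C / 4) + ((uR 4 1 + C / 4) + φ) - (uR 4 3 + C / 4))) * s
        = C * s + 4 * (uR 2 1 * s) + 2 * (uR 3 1 * s) - 2 * (uR 4 1 * s) - 2 * (uR 3 2 * s)
          + 2 * (uR 4 3 * s) - 2 * (φ * s) := by ring
    rw [expand]
    linarith
  have hnn : 0 ≤ (2 * (uR 2 1 + C / 4) + 2 * (uR 3 1 + C / 4) + (2 * (uR 4 1 + C / 4) + 2 * φ)
      + 2 * ((uR 2 1 + C / 4) + (uR 3 1 + C / 4) - (uR 3 2 + C / 4))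
      - 2 * ((uR 4 1 + C / 4) + φ)
      - 2 * ((uR 3 1 + C / 4) + ((uR 4 1 + C / 4) + φ) - (uR 4 3 + C / 4))) * s :=
    mul_nonneg hq hSC.le
  linarith

/-- **CALIBRATION PIN at `p = 3` (RH-free, kernel):** every W→S transfer uniform over the kept class has
`f((log 3)/2) ≤ 3 = e^{2a}`. [folklore] -/
theorem uniformWSTransfer_pin_three {f : ℝ → ℕ} (hT : UniformWSTransfer f) : f (Real.log 3 / 2) ≤ 3 := by
  have h := uniformWSTransfer_pin hT Nat.prime_three (by norm_num) keptScrewMatrix_three_not_posSemidef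
  exact_mod_cast h

end RhIdea6.G14.Transfer
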